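import Literature.MathematicalPhysics.QuantumFieldTheory.BalabanImbrieJaffe1984to88.BIJ88OneCubeVertexFactors309
import Literature.MathematicalPhysics.QuantumFieldTheory.BalabanImbrieJaffe1984to88.BIJ88Ineq5144Located
import Literature.MathematicalPhysics.QuantumFieldTheory.BalabanImbrieJaffe1984to88.BIJ88W6PrimeVsuppBound

/-!
# `BalabanImbrieJaffe1984to88.BIJ88Ineq5144OneCube` — T. Bałaban, J. Imbrie, A. Jaffe, *Effective action and cluster properties of the abelian
Higgs model*, Commun. Math. Phys. **114** (1988) 257–315 [BalabanImbrieJaffe1988], Sect. 5.14, (5.14.4) p. 309 [PDF 53]: **THE LEAF (5.14.4) PROVED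
ON THE ONE-CUBE POLYMERS `|X_β| = 1` IN THE §5.13 MODEL, LOCATED READING, FOR THE p. 308 SLOT DATA AND A GENERAL COUPLING `Δ ≻ 0`** (file 3 of 3;
siblings `BIJ88OneCubeSlotEstimates309`, `BIJ88OneCubeVertexFactors309`).

statement-level skeleton of published theorems with citation tags; proofs where landed; nothing here is a claim about the Yang–Mills mass gap

p. 309, verbatim: *"If |X_β| = 1, H_β = ∅, we write g₃(∅, X_β) = 1 + g₃′(∅, X_β) … Let us drop the prime, and prove that
|g₃(H_β, X_β)| ≤ (e^β(L^kε/ε₀)^{1/4−α})^{[|H_β| + β′|X_β∖H_β|]}. (5.14.4) We use X_β∖H_β to denote the set of cubes with no (d/dt)_{γ_j} factors,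
j ∈ H_β. The proof of this estimate is similar to the one for g₂. We mention only the new features. Each factor V^{(k)}(Y) in Π (d/dt)_{γ_j} produces
a factor e^β(L^kε/ε₀)^{1/4−α} … Each t-derivative of a χ-factor in χ′_{Λ₁₂^{(k)},t} gives at least a factor e^β(L^kε/ε₀)^{1/4−α}. … The bound for
H_β = ∅, |X_β| = 1 was obtained for g₂, and the same proof applies here."* (p. 307: *"|g₂(X_α) − 1| ≤ e^β(L^kε/ε₀)^{1/4−α}"*); p. 305: a single cube
carries no interpolation (`□Δ_s□ = □Δ□`).  PDF held: `paper:balaban1988-cmp114-bij-abelian-higgs-effective-action` (journal page = PDF page + 256);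
pp. 305, 307–312 = PDF 49, 51–56 read this generation (`p0049.txt` L13–14: *"for i″ ≠ i or i′, or for i = i′, □_i(∂^ΓΔ)□_{i′} = □_iΔ□_{i′}"*).

WHAT IS REPRODUCED (unit `lit-balaban-p36`, generation 15 of the Phase-2 proof seat p36; SKELETON row **C2.Eq5.14.3-5.14.4** (typed leaf
`BIJ88Sect5StatementsPart2.Ineq5144`, located reading `BIJ88Ineq5144Located.locAct` of gen 14) member cell of `HOME/lit-balaban-r16/ROWS-C2-part2.md`,
owner r16, head untouched; HOME `run/shared/lean/pub/lit-balaban/`).  For the located data of this seat's gens 11–14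
(`BIJ88W6PrimeVsupp.actIn blk Δ ℱ adj χ p ek B Φ c Ys V cube Λ X t γ` — the prime-dropped activities `g₃` of the corner expectations of the p. 308
derivative observables, region `X`, corner `Λ`, time `t`, assignment `γ`), theorems only (0 definitions, 0 `Prop` facts):
* §3 `regionLaw_singleton_eq` (the one-cube law at any corner of any resummed form is the law of `□_i` for `Δ`), **`actIn_singleton_eq`** (the
  activity of `(H, {i})` = `∫ Π_{τ ⊂ □_i} (d/dt)^{#{j ∈ H : γ_j = τ}} slotFactor_τ d law(□_i) − [H = ∅]`, by p25's `g1_singleton`),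
  `sum_card_filter_eq_card`, **`ineq5144_locAct_singleton_of_const`** (the core, for a GIVEN all-orders derivative constant `Ĉ`) and
  **`ineq5144_locAct_singleton`**: there is `Ĉ = Ĉ(χ,p,n₀) ≥ 1` such that for `Δ ≻ 0` (ANY coupling), `χ ≥ 0`,
  `c_b ≥ c₀ > 0`, measurable slot fields with one-cube sub-Gaussian tails `law(□_i){a ≤ |Φ_b|} ≤ Ae^{−κa²}`, measurable terms `|V(Y)| ≤ K_Y ≤ K₁`,
  `≤ G` slots per cube, `0 < e_k ≤ e⁻¹`, in the regime of sibling 2 (`e_k ≤ θ`, `n₀ + 1 ≤ κ(81/100)c₀²|log e_k⁻¹|^{2p−1}`, `Ĉ^{n₀}Ae^{GK₁}e_k ≤ 1`,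
  `K_Y e^{GK₁} ≤ θ`, `e^{GK₁}GAe_k + (e^{GK₁} − 1) ≤ θ^{β′}`), for EVERY `Λ`, `X`, `t ∈ (0,1]`, `|L| ≤ n₀`, `γ`, `H` and `|X₁| = 1`:
  `|locAct (cubeIn ∘ γ) (actIn … t γ) H X₁| ≤ θ^{|H| + β′|X₁ ∖ loc(H)|}` — (5.14.4) AS TYPED, on the one-cube polymers.
* §4 **`ineq5144_locAct_singleton_of_mod`**: the tail hypothesis DISCHARGED for the two χ-species of p. 308 (linear `(I−Q_s*Q)A^{(k)}` and modulus
  `|φ^{(k)}|` slot fields — `hmod` of the C2.Eq5.14.5 head `BIJ88Eq5145CornerW6Loc.eq5145_zG_mod_W6v_of_ineq5144_loc`) from mean and variance bounds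
  `μ₀, v` under the one-cube laws (`A = 4e^{μ₀²/(2v)}`, `κ = 1/(8v)`, gen 13's `BIJ88GaussShellModulus309.tail_slotField_fieldLaw_of_mod`).
* §5 **`ineq5144_locAct_singleton_uniform`**: ONE `Ĉ` for ALL data and ALL `e_k` (the closed form with `Ĉ` chosen before the datum and `e_k`, so
  that the `e_k`-smallness conditions are conditions at fixed `Ĉ`).
* §6 **`ineq5144_locAct_iff_two_le`**: in that regime r16's located leaf `Ineq5144 … (locAct …)` for the data of a region at `(Λ, t, γ)` — the
  `h5144` of the C2.Eq5.14.5 head — is EQUIVALENT to its part on the polymers with `≥ 2` cubes (what remains is the cluster-expansion decay).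
HONEST SCOPE: this is the `|X_β| = 1` part of (5.14.4) only — the part whose mechanism p. 309 spells out (derivative factors on one cube; the vacuum
bound of p. 307); the MULTI-CUBE polymers (`|X_β| ≥ 2`: the inductive cluster-expansion decay in `|X_β|`, p. 309 *"similar to the one for g₂"*,
§5.13) are NOT treated, so the located leaf `h5144` of the C2.Eq5.14.5 head is discharged here on one-cube polymers only; the means `μ₀` (p. 307
*"here we use the fact that the translation vanishes"*) and variances `v` are inputs; bounded terms `V(Y)` as in the whole §5.13 model of this
lineage.  0 `sorry`, 0 definitions, 0 `Prop` facts (D-0026); imports `BIJ88OneCubeVertexFactors309` (p36 g15), `BIJ88Ineq5144Located` (p36 g14),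
`BIJ88W6PrimeVsuppBound` (p36 g13); modifies nothing.  NOT summit progress; NOT continuum; NOT Clay.  Cell `lit-balaban` Phase 2, seat p36 gen 15
(owner r16 — the row's head pointer is r16's call; referee ref-5).  v1.1 (same seat and generation, append-only): the core re-stated for a GIVEN
constant `Ĉ` (`ineq5144_locAct_singleton_of_const`, the v1.0 theorem becoming its corollary with unchanged statement) and the closed form with
`Ĉ` chosen BEFORE the datum and `e_k` (`ineq5144_locAct_singleton_uniform`) — in v1.0's closed form `e_k` was bound before `Ĉ`.  v1.2: §6, the
reduction of the located leaf to its multi-cube part (`ineq5144_locAct_iff_two_le`).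
-/

noncomputable section

open Finset MeasureTheory ProbabilityTheory
open Literature.MathematicalPhysics.QuantumFieldTheory.BalabanImbrieJaffe1984to88
open BIJ88Sect2Statements (pLog)
open BIJ88Sect5Statements (CutoffProfile cutoff)
open BIJ88SlotMoments308 (slotFactor)
open BIJ88GaussIntegration309Product (exists_const_all_orders)
open BIJ88DirichletForms305 (interpForm interpForm_apply)
open BIJ88PolymerRep5134 (g1 g1_singleton g1_empty corner)
open BIJ88PolymerRep5134Gauss (ext obs prec zG)
open BIJ88Expansion5143 (g3 prime)
open BIJ88Expansion5143Gauss (fD)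
open BIJ88SlotMomentsGauss308 (uD fieldLaw isProbabilityMeasure_fieldLaw measurable_ext)
open BIJ88Eq5145CornerModel (slotB slotY mem_slotB mem_slotY regionLaw zG_eq_integral_regionLaw prec_corner_posDef)
open BIJ88Eq5145CornerUrsell (cubeIn cubeIn_mem)
open BIJ88W6PrimeVsupp (actIn)
open BIJ88W6PrimeVsuppBound (card_filter_cubeIn_le)
open BIJ88Ineq5144Located (locAct locAct_of_loc locAct_of_not_loc)
open BIJ88Ineq5113Covering (cubeSys)
open BIJ88Sect5StatementsPart2 (Ineq5144)
open BIJ88OneCubeVertexFactors309 (abs_integral_prod_iteratedDeriv_slotFactor_le_pow abs_integral_prod_slotFactor_sub_one_le_rpow)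

namespace Literature.MathematicalPhysics.QuantumFieldTheory.BalabanImbrieJaffe1984to88.BIJ88Ineq5144OneCube

/-! ## §3 The §5.13 model: (5.14.4) ON THE ONE-CUBE POLYMERS for the located data of every region

The data of this seat's gens 11–14 (`BIJ88W6PrimeVsupp.actIn`): real fields on finitely many sites, cube map `blk`, precision `Δ ≻ 0` (ANY
coupling — a single cube carries no interpolation, p. 305 *"□Δ_s□ = □Δ□"*), source `ℱ`, χ-slots `b ∈ B` with slot fields `Φ_b` and thresholds
`c_b p(te_k)`, interaction slots `Y ∈ Ys` with terms `V(Y)`, cube map `cube` of the slots; the located data of the region `X` at the corner `Λ`,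
time `t`, assignment `γ` of the derivative labels `L` to the slots located in `X`. -/

section Model

variable {α I : Type} [Fintype α] [DecidableEq α] [Fintype I] [DecidableEq I]
  (blk : α → I) (Δ : Matrix α α ℝ) (ℱ : α → ℝ)
variable (adj : I → I → Prop) [DecidableRel adj]
variable (χ : CutoffProfile) {ι υ : Type*} [DecidableEq ι] [DecidableEq υ]
variable {p ek : ℝ} {B : Finset ι} {Φ : ι → (α → ℝ) → ℝ} {c : ι → ℝ} {Ys : Finset υ} {V : υ → (α → ℝ) → ℝ}
variable (cube : ↥B ⊕ ↥Ys → I)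

/-- **a single cube carries no interpolation** (p. 305: *"for i = i′, □_i(∂^ΓΔ)□_{i′} = □_iΔ□_{i′}"* — the diagonal blocks of `Δ_s` are those of
`Δ`): the law of the fields of the one-cube
region `{i}` at any corner of any resummed form `Δ_{1_Λ}` is the law of the fields of `□_i` for `Δ` itself.
[cite: BalabanImbrieJaffe1988, p.305 (Sect. 5.13)] -/
theorem regionLaw_singleton_eq (Λ : Finset I) (i : I) :
    regionLaw blk (interpForm blk Δ (corner ℝ Λ)) ℱ {i} {i} = fieldLaw blk Δ ℱ {i} := by
  have h : prec blk (interpForm blk (interpForm blk Δ (corner ℝ Λ)) (corner ℝ ({i} : Finset I))) {i} (corner ℝ {i}) =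
      prec blk Δ {i} (corner ℝ {i}) := by
    ext x y
    have hx : blk x.1 = i := mem_singleton.1 x.2
    have hy : blk y.1 = i := mem_singleton.1 y.2
    simp only [prec, Matrix.submatrix_apply, interpForm_apply, hx, hy, if_true]
  unfold regionLaw BIJ88SlotMomentsGauss308.fieldLaw
  rw [h]

/-- **THE ONE-CUBE ACTIVITY AS AN INTEGRAL**: the prime-dropped activity of the pair `(H, {i})` for the located data of `X` is the expectation,
in the law of the fields of `□_i`, of the product over the slots located in `□_i` of their slot factors differentiated as many times as `H`
assigns labels to them — minus `1` when `H = ∅` (p. 309: *"g₃(∅, X_β) = 1 + g₃′(∅, X_β)"*; p25's `g1_singleton`: the activity of a one-cube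
polymer is the corner expectation itself). [cite: BalabanImbrieJaffe1988, (5.14.3)–(5.14.4) p.309] -/
theorem actIn_singleton_eq (Λ X : Finset I) (t : ℝ) {L : Type*} [DecidableEq L]
    (γ : L → ↥(slotB B Ys cube X) ⊕ ↥(slotY B Ys cube X)) (H : Finset L) (i : I) :
    actIn blk Δ ℱ adj χ p ek B Φ c Ys V cube Λ X t γ H {i} =
      (∫ ω, ∏ τ ∈ univ.filter (fun τ => cubeIn cube X τ = i),
          iteratedDeriv ((H.filter fun j => γ j = τ).card)
            (slotFactor χ p ek (slotB B Ys cube X) (fun b ω => Φ b (ext blk {i} ω)) (fun b => c b) (slotY B Ys cube X)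
              (fun Y ω => V Y (ext blk {i} ω)) ω τ) t ∂(fieldLaw blk Δ ℱ {i})) -
        if H = ∅ then 1 else 0 := by
  simp only [actIn, prime, g3, g1_singleton, card_singleton, and_true]
  rw [zG_eq_integral_regionLaw, regionLaw_singleton_eq]
  congr 1
  refine integral_congr_ae (Filter.Eventually.of_forall fun ω => ?_)
  simp only [obs, prod_singleton, fD, uD]
  refine prod_congr rfl fun τ _ => ?_
  rcases τ with b | Y <;> rfl

omit [Fintype I] in
/-- for a label set located in `□_i`, the multiplicities of the slots of `□_i` add up to `|H|` (each label differentiates exactly one slot).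
[cite: BalabanImbrieJaffe1988, (5.14.3) p.309] -/
theorem sum_card_filter_eq_card (X : Finset I) {L : Type*} [DecidableEq L]
    (γ : L → ↥(slotB B Ys cube X) ⊕ ↥(slotY B Ys cube X)) {H : Finset L} {i : I} (hH : ∀ j ∈ H, cubeIn cube X (γ j) = i) :
    ∑ τ ∈ univ.filter (fun τ => cubeIn cube X τ = i), (H.filter fun j => γ j = τ).card = H.card :=
  (card_eq_sum_card_fiberwise fun j hj => mem_filter.2 ⟨mem_univ _, hH j hj⟩).symm

/-- **(5.14.4) ON THE ONE-CUBE POLYMERS, IN THE MODEL, LOCATED READING — FOR A GIVEN ALL-ORDERS DERIVATIVE CONSTANT `Ĉ`** (the core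
statement; `Ĉ ≥ 1` any constant with `|(d/dt)ⁱ χ(q p(te_k), A)| ≤ Ĉ t^{−i}` for `i ≤ n₀`, e.g. the one of
`BIJ88GaussIntegration309Product.exists_const_all_orders χ p n₀`, which depends on `χ, p, n₀` ONLY — so the `e_k`-smallness conditions below are
conditions on `e_k` at fixed `Ĉ`): hypotheses and conclusion as in `ineq5144_locAct_singleton` below.
[cite: BalabanImbrieJaffe1988, (5.14.4) p.309; p.307 (Sect. 5.13)] -/
theorem ineq5144_locAct_singleton_of_const [Fintype ι] [Fintype υ] (hp : 1 / 2 < p) {n₀ : ℕ} {C : ℝ} (hC1 : 1 ≤ C)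
    (hC : ∀ i, i ≤ n₀ → ∀ (A : ℝ) ⦃q e t : ℝ⦄, q ≠ 0 → 0 < e → 0 < t → t * e ≤ Real.exp (-1) →
      |iteratedDeriv i (fun s => cutoff χ (q * pLog p (s * e)) A) t| ≤ C * t ^ (-(i : ℤ)))
    (hΔ : Δ.PosDef) (hχ : ∀ x, 0 ≤ χ.χ₁ x) {c₀ : ℝ} (hc₀ : 0 < c₀) (hcb : ∀ b ∈ B, c₀ ≤ c b)
    (hΦm : ∀ b ∈ B, Measurable (Φ b)) (hV : ∀ Y ∈ Ys, Measurable (V Y)) {KY : υ → ℝ} (hK : ∀ Y ∈ Ys, ∀ φ, |V Y φ| ≤ KY Y)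
    {K₁ : ℝ} (hK₁0 : 0 ≤ K₁) (hK₁ : ∀ Y ∈ Ys, KY Y ≤ K₁) {G : ℕ} (hG : ∀ i, (univ.filter fun τ : ↥B ⊕ ↥Ys => cube τ = i).card ≤ G)
    {A κ : ℝ} (hA : 0 ≤ A) (hκ : 0 ≤ κ)
    (htail : ∀ (i : I) (b : ↥B), cube (Sum.inl b) = i → ∀ a : ℝ, 0 ≤ a →
      (fieldLaw blk Δ ℱ {i}).real {ω | a ≤ |Φ b (ext blk {i} ω)|} ≤ A * Real.exp (-(κ * a ^ 2)))
    (hek : 0 < ek) (hek1 : ek ≤ Real.exp (-1)) {θ β' : ℝ} (hekθ : ek ≤ θ)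
    (hreg : (n₀ : ℝ) + 1 ≤ κ * (81 / 100) * c₀ ^ 2 * Real.log ek⁻¹ ^ (2 * p - 1))
    (hpre : C ^ n₀ * A * Real.exp (G * K₁) * ek ≤ 1) (hKθ : ∀ Y ∈ Ys, KY Y * Real.exp (G * K₁) ≤ θ)
    (hvac : Real.exp (G * K₁) * G * A * ek + (Real.exp (G * K₁) - 1) ≤ θ ^ β')
    (Λ X : Finset I) {t : ℝ} (ht : t ∈ Set.Ioc (0 : ℝ) 1) {L : Type} [Fintype L] [DecidableEq L] (hL : Fintype.card L ≤ n₀)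
    (γ : L → ↥(slotB B Ys cube X) ⊕ ↥(slotY B Ys cube X)) (H : Finset L) (X₁ : Finset I) (hX₁ : X₁.card = 1) :
    |locAct (cubeIn cube X ∘ γ) (actIn blk Δ ℱ adj χ p ek B Φ c Ys V cube Λ X t γ) H X₁| ≤
      θ ^ ((H.card : ℝ) + β' * ((X₁ \ H.image (cubeIn cube X ∘ γ)).card : ℝ)) := by
  obtain ⟨i, rfl⟩ := card_eq_one.1 hX₁
  have hθ0 : 0 < θ := hek.trans_le hekθ
  by_cases hloc : ∀ j ∈ H, (cubeIn cube X ∘ γ) j ∈ ({i} : Finset I)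
  swap
  · rw [locAct_of_not_loc hloc, abs_zero]
    exact Real.rpow_nonneg hθ0.le _
  rw [locAct_of_loc hloc, actIn_singleton_eq]
  have hH : ∀ j ∈ H, cubeIn cube X (γ j) = i := fun j hj => mem_singleton.1 (hloc j hj)
  -- the one-cube probability space and the slot family of `□_i`
  haveI : IsProbabilityMeasure (fieldLaw blk Δ ℱ {i}) := isProbabilityMeasure_fieldLaw blk Δ ℱ {i} (prec_corner_posDef blk Δ hΔ {i} {i})
  set T : Finset (↥(slotB B Ys cube X) ⊕ ↥(slotY B Ys cube X)) := univ.filter (fun τ => cubeIn cube X τ = i) with hT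
  have hTl : ∀ b ∈ T.toLeft, cube (Sum.inl b.1) = i := fun b hb => by
    have h := (mem_filter.1 (Finset.mem_toLeft.1 hb)).2; exact h
  have hTr : ∀ Y ∈ T.toRight, cube (Sum.inr Y.1) = i := fun Y hY => by
    have h := (mem_filter.1 (Finset.mem_toRight.1 hY)).2; exact h
  have hcb' : ∀ b ∈ T.toLeft, c₀ ≤ (fun b : ↥B => c b) b.1 := fun b _ => hcb b.1 b.1.2
  have hK' : ∀ Y ∈ T.toRight, ∀ ω : {x : α // blk x ∈ ({i} : Finset I)} → ℝ,
      |(fun (Y : ↥Ys) ω => V Y (ext blk {i} ω)) Y.1 ω| ≤ (fun Y : ↥Ys => KY Y) Y.1 := fun Y _ ω => hK Y.1 Y.1.2 _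
  have hKY0 : ∀ Y ∈ T.toRight, 0 ≤ (fun Y : ↥Ys => KY Y) Y.1 := fun Y _ => (abs_nonneg _).trans (hK Y.1 Y.1.2 0)
  have hΦ' : ∀ b ∈ T.toLeft, Measurable fun ω : {x : α // blk x ∈ ({i} : Finset I)} → ℝ =>
      (fun (b : ↥B) ω => Φ b (ext blk {i} ω)) b.1 ω := fun b _ => (hΦm b.1 b.1.2).comp (measurable_ext blk {i})
  have hV' : ∀ Y ∈ T.toRight, Measurable fun ω : {x : α // blk x ∈ ({i} : Finset I)} → ℝ =>
      (fun (Y : ↥Ys) ω => V Y (ext blk {i} ω)) Y.1 ω := fun Y _ => (hV Y.1 Y.1.2).comp (measurable_ext blk {i})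
  have htail' : ∀ b ∈ T.toLeft, ∀ a : ℝ, 0 ≤ a →
      (fieldLaw blk Δ ℱ {i}).real {ω | a ≤ |(fun (b : ↥B) ω => Φ b (ext blk {i} ω)) b.1 ω|} ≤ A * Real.exp (-(κ * a ^ 2)) :=
    fun b hb a ha => htail i b.1 (hTl b hb) a ha
  -- slots per cube: `|T| ≤ G`, hence the interaction weight `Σ_{Y} K_Y ≤ G K₁`
  have hTG : T.card ≤ G := (card_filter_cubeIn_le (cube := cube) X i).trans (hG i)
  have hKsum : ∑ Y ∈ T.toRight, (fun Y : ↥Ys => KY Y) Y.1 ≤ G * K₁ := by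
    refine (sum_le_card_nsmul _ _ K₁ fun Y _ => hK₁ Y.1 Y.1.2).trans ?_
    rw [nsmul_eq_mul]
    have h : ((T.toRight).card : ℝ) ≤ G := by exact_mod_cast (Finset.card_toRight_le).trans hTG
    exact mul_le_mul_of_nonneg_right h hK₁0
  have hGl : ((T.toLeft).card : ℝ) ≤ G := by exact_mod_cast (Finset.card_toLeft_le).trans hTG
  by_cases hH0 : H = ∅
  · -- the vacuum polymer `(∅, {i})`: *"g₃(∅, X_β) = 1 + g₃′(∅, X_β)"*, `|g₃′| ≤ θ^{β′}`
    subst hH0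
    have hreg1 : (1 : ℝ) ≤ κ * (81 / 100) * c₀ ^ 2 * Real.log ek⁻¹ ^ (2 * p - 1) :=
      le_trans (by have := Nat.cast_nonneg (α := ℝ) n₀; linarith) hreg
    simp only [filter_empty, card_empty, iteratedDeriv_zero, if_true, image_empty, sdiff_empty, card_singleton, Nat.cast_zero,
      zero_add, Nat.cast_one, mul_one]
    exact abs_integral_prod_slotFactor_sub_one_le_rpow χ (fieldLaw blk Δ ℱ {i}) p ek (slotB B Ys cube X)
      (fun b ω => Φ b (ext blk {i} ω)) (fun b => c b) (slotY B Ys cube X) (fun Y ω => V Y (ext blk {i} ω)) hχ hp hek hek1 ht.1 ht.2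
      T hc₀ hcb' (fun Y => KY Y) hK' hKsum hΦ' hV' hA hκ htail' hGl hreg1 hvac
  · -- derivatives located in `□_i`: `|{i} ∖ loc(H)| = 0`, `Σ_τ m_τ = |H|`
    have hne : H.Nonempty := nonempty_iff_ne_empty.2 hH0
    rw [if_neg hH0, sub_zero]
    have himg : ({i} : Finset I) \ H.image (cubeIn cube X ∘ γ) = ∅ := by
      obtain ⟨j, hj⟩ := hne
      exact sdiff_eq_empty_iff_subset.2 (singleton_subset_iff.2 (mem_image.2 ⟨j, hj, hH j hj⟩))
    rw [himg, card_empty, Nat.cast_zero, mul_zero, add_zero, Real.rpow_natCast]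
    have hsumT := sum_card_filter_eq_card cube X γ hH
    rw [← hT] at hsumT
    rw [← hsumT]
    refine abs_integral_prod_iteratedDeriv_slotFactor_le_pow χ (fieldLaw blk Δ ℱ {i}) p ek (slotB B Ys cube X)
      (fun b ω => Φ b (ext blk {i} ω)) (fun b => c b) (slotY B Ys cube X) (fun Y ω => V Y (ext blk {i} ω)) hC1 hC hp hek hek1 ht.1
      ht.2 T (fun τ => (H.filter fun j => γ j = τ).card) ?_ ?_ hc₀ hcb' (fun Y => KY Y) hK' hKY0 hKsum hΦ' hA hκ htail' hekθ hreg
      hpre fun Y _ => hKθ Y.1 Y.1.2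
    · rw [hsumT]; exact (card_le_univ H).trans hL
    · rw [hsumT]; exact hne.card_pos

/-- **(5.14.4) ON THE ONE-CUBE POLYMERS, IN THE MODEL, LOCATED READING** (p. 309 [PDF 53]: *"|g₃(H_β, X_β)| ≤ (e^β(L^kε/ε₀)^{1/4−α})^{[|H_β| +
β′|X_β∖H_β|]} (5.14.4) … Each factor V^{(k)}(Y) in Π (d/dt)_{γ_j} produces a factor e^β(L^kε/ε₀)^{1/4−α} in the final estimate. … Each t-derivative
of a χ-factor in χ′_{Λ₁₂^{(k)},t} gives at least a factor e^β(L^kε/ε₀)^{1/4−α}. … After integration over A^{(k)}, we obtain factors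
ct^{−n}e^{−cp(te_k)²} ≤ (e^β(L^kε/ε₀)^{1/4−α})ⁿ. Similar bounds hold for φ^{(k)}. The bound for H_β = ∅, |X_β| = 1 was obtained for g₂, and the same
proof applies here"*).  There is an all-orders derivative constant `Ĉ = Ĉ(χ, p, n₀) ≥ 1` such that, for the §5.13 data with `Δ ≻ 0` (any coupling),
`χ ≥ 0`, thresholds `c_b ≥ c₀ > 0`, measurable slot fields whose ONE-CUBE LAWS have the sub-Gaussian tail `law(□_i){a ≤ |Φ_b|} ≤ A e^{−κa²}`
(`a ≥ 0`; linear or modulus slot fields have it: `BIJ88GaussShellModulus309.tail_slotField_fieldLaw_of_mod`), measurable terms `|V(Y)| ≤ K_Y ≤ K₁`,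
at most `G` slots per cube, `0 < e_k ≤ e⁻¹`, and in the `e_k`-small regime
`e_k ≤ θ` · `n₀ + 1 ≤ κ(81/100)c₀²|log e_k⁻¹|^{2p−1}` · `Ĉ^{n₀}·A·e^{GK₁}·e_k ≤ 1` · `K_Y e^{GK₁} ≤ θ` · `e^{GK₁}·G·A·e_k + (e^{GK₁} − 1) ≤ θ^{β′}`:
for EVERY corner `Λ`, region `X`, `t ∈ (0,1]`, label type `L` with `|L| ≤ n₀`, assignment `γ`, label set `H` and one-cube polymer `X₁` (`|X₁| = 1`),
the located activity obeys (5.14.4) as typed (`BIJ88Sect5StatementsPart2.Ineq5144` with `nH = card`, `nRest H X = |X ∖ loc(H)|`, restricted to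
`|X| = 1`): `|locAct (cubeIn ∘ γ) (actIn … t γ) H X₁| ≤ θ^{|H| + β′|X₁ ∖ loc(H)|}`.  The multi-cube polymers
(`|X_β| ≥ 2`: the inductive cluster-expansion decay, p. 309 *"The proof of this estimate is similar to the one for g₂"*) are NOT treated here.
[cite: BalabanImbrieJaffe1988, (5.14.4) p.309; p.307 (Sect. 5.13)] -/
theorem ineq5144_locAct_singleton [Fintype ι] [Fintype υ] (hp : 1 / 2 < p) (n₀ : ℕ) :
    ∃ C : ℝ, 1 ≤ C ∧ ∀ (_hΔ : Δ.PosDef) (_hχ : ∀ x, 0 ≤ χ.χ₁ x) {c₀ : ℝ} (_hc₀ : 0 < c₀) (_hcb : ∀ b ∈ B, c₀ ≤ c b)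
      (_hΦm : ∀ b ∈ B, Measurable (Φ b)) (_hV : ∀ Y ∈ Ys, Measurable (V Y)) {KY : υ → ℝ} (_hK : ∀ Y ∈ Ys, ∀ φ, |V Y φ| ≤ KY Y)
      {K₁ : ℝ} (_hK₁0 : 0 ≤ K₁) (_hK₁ : ∀ Y ∈ Ys, KY Y ≤ K₁) {G : ℕ} (_hG : ∀ i, (univ.filter fun τ : ↥B ⊕ ↥Ys => cube τ = i).card ≤ G)
      {A κ : ℝ} (_hA : 0 ≤ A) (_hκ : 0 ≤ κ)
      (_htail : ∀ (i : I) (b : ↥B), cube (Sum.inl b) = i → ∀ a : ℝ, 0 ≤ a →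
        (fieldLaw blk Δ ℱ {i}).real {ω | a ≤ |Φ b (ext blk {i} ω)|} ≤ A * Real.exp (-(κ * a ^ 2)))
      (_hek : 0 < ek) (_hek1 : ek ≤ Real.exp (-1)) {θ β' : ℝ} (_hekθ : ek ≤ θ) (_hβ : 0 ≤ β')
      (_hreg : (n₀ : ℝ) + 1 ≤ κ * (81 / 100) * c₀ ^ 2 * Real.log ek⁻¹ ^ (2 * p - 1))
      (_hpre : C ^ n₀ * A * Real.exp (G * K₁) * ek ≤ 1) (_hKθ : ∀ Y ∈ Ys, KY Y * Real.exp (G * K₁) ≤ θ)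
      (_hvac : Real.exp (G * K₁) * G * A * ek + (Real.exp (G * K₁) - 1) ≤ θ ^ β')
      (Λ X : Finset I) {t : ℝ} (_ht : t ∈ Set.Ioc (0 : ℝ) 1) {L : Type} [Fintype L] [DecidableEq L] (_hL : Fintype.card L ≤ n₀)
      (γ : L → ↥(slotB B Ys cube X) ⊕ ↥(slotY B Ys cube X)) (H : Finset L) (X₁ : Finset I) (_hX₁ : X₁.card = 1),
      |locAct (cubeIn cube X ∘ γ) (actIn blk Δ ℱ adj χ p ek B Φ c Ys V cube Λ X t γ) H X₁| ≤
        θ ^ ((H.card : ℝ) + β' * ((X₁ \ H.image (cubeIn cube X ∘ γ)).card : ℝ)) := by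
  obtain ⟨C, hC1, hC⟩ := exists_const_all_orders χ p n₀
  exact ⟨C, hC1, fun hΔ hχ _ hc₀ hcb hΦm hV _ hK _ hK₁0 hK₁ _ hG _ _ hA hκ htail hek hek1 _ _ hekθ _ hreg hpre hKθ hvac Λ X _ ht _ _ _ hL
    γ H X₁ hX₁ => ineq5144_locAct_singleton_of_const blk Δ ℱ adj χ cube hp hC1 hC hΔ hχ hc₀ hcb hΦm hV hK hK₁0 hK₁ hG hA hκ htail hek
      hek1 hekθ hreg hpre hKθ hvac Λ X ht hL γ H X₁ hX₁⟩

/-! ## §4 The tail input discharged for the two χ-species of p. 308 (linear and modulus slot fields) -/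

/-- **(5.14.4) ON THE ONE-CUBE POLYMERS FOR LINEAR-OR-MODULUS SLOT FIELDS** (p. 308: *"χ(cp(e_k), (I−Q_s*Q)A^{(k)})"* — a linear functional
of the field — *"and similarly for χ(cp(e_k), φ^{(k)})"* — the modulus `|φ| = √(Re φ² + Im φ²)` of two linear functionals; p. 309: *"Similar bounds
hold for φ^{(k)}"*): the previous theorem with the tail hypothesis DISCHARGED by this seat's `BIJ88GaussShellModulus309.tail_slotField_fieldLaw_of_mod`
— under the one-cube laws the functionals `ℓ₁, ℓ₂` are Gaussian (`Δ ≻ 0`), and mean bounds `|E ℓ_j| ≤ μ₀`, variance bounds `Var ℓ_j ≤ v` give the tail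
constants `A = 4e^{μ₀²/(2v)}`, `κ = 1/(8v)` (p. 307: *"here we use the fact that the translation vanishes"* — in the model the means are an input).
[cite: BalabanImbrieJaffe1988, (5.14.4) p.309; (5.14.2) p.308; p.307 (Sect. 5.13)] -/
theorem ineq5144_locAct_singleton_of_mod [Fintype ι] [Fintype υ] (hp : 1 / 2 < p) (n₀ : ℕ) :
    ∃ C : ℝ, 1 ≤ C ∧ ∀ (_hΔ : Δ.PosDef) (_hχ : ∀ x, 0 ≤ χ.χ₁ x) {c₀ : ℝ} (_hc₀ : 0 < c₀) (_hcb : ∀ b ∈ B, c₀ ≤ c b)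
      {ℓ₁ ℓ₂ : ι → (α → ℝ) → ℝ} (_hℓ₁ : ∀ b ∈ B, IsLinearMap ℝ (ℓ₁ b)) (_hℓ₂ : ∀ b ∈ B, IsLinearMap ℝ (ℓ₂ b))
      (_hΦ : ∀ b ∈ B, (∀ φ, Φ b φ = ℓ₁ b φ) ∨ (∀ φ, Φ b φ = Real.sqrt (ℓ₁ b φ ^ 2 + ℓ₂ b φ ^ 2)))
      {μ₀ v : ℝ} (_hv : 0 < v)
      (_hmean : ∀ (i : I) (b : ↥B), cube (Sum.inl b) = i →
        |∫ ω, ℓ₁ b (ext blk {i} ω) ∂(fieldLaw blk Δ ℱ {i})| ≤ μ₀ ∧ |∫ ω, ℓ₂ b (ext blk {i} ω) ∂(fieldLaw blk Δ ℱ {i})| ≤ μ₀)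
      (_hvar : ∀ (i : I) (b : ↥B), cube (Sum.inl b) = i →
        Var[fun ω => ℓ₁ b (ext blk {i} ω); fieldLaw blk Δ ℱ {i}] ≤ v ∧ Var[fun ω => ℓ₂ b (ext blk {i} ω); fieldLaw blk Δ ℱ {i}] ≤ v)
      (_hV : ∀ Y ∈ Ys, Measurable (V Y)) {KY : υ → ℝ} (_hK : ∀ Y ∈ Ys, ∀ φ, |V Y φ| ≤ KY Y)
      {K₁ : ℝ} (_hK₁0 : 0 ≤ K₁) (_hK₁ : ∀ Y ∈ Ys, KY Y ≤ K₁) {G : ℕ} (_hG : ∀ i, (univ.filter fun τ : ↥B ⊕ ↥Ys => cube τ = i).card ≤ G)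
      (_hek : 0 < ek) (_hek1 : ek ≤ Real.exp (-1)) {θ β' : ℝ} (_hekθ : ek ≤ θ) (_hβ : 0 ≤ β')
      (_hreg : (n₀ : ℝ) + 1 ≤ 1 / (8 * v) * (81 / 100) * c₀ ^ 2 * Real.log ek⁻¹ ^ (2 * p - 1))
      (_hpre : C ^ n₀ * (4 * Real.exp (μ₀ ^ 2 / (2 * v))) * Real.exp (G * K₁) * ek ≤ 1)
      (_hKθ : ∀ Y ∈ Ys, KY Y * Real.exp (G * K₁) ≤ θ)
      (_hvac : Real.exp (G * K₁) * G * (4 * Real.exp (μ₀ ^ 2 / (2 * v))) * ek + (Real.exp (G * K₁) - 1) ≤ θ ^ β')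
      (Λ X : Finset I) {t : ℝ} (_ht : t ∈ Set.Ioc (0 : ℝ) 1) {L : Type} [Fintype L] [DecidableEq L] (_hL : Fintype.card L ≤ n₀)
      (γ : L → ↥(slotB B Ys cube X) ⊕ ↥(slotY B Ys cube X)) (H : Finset L) (X₁ : Finset I) (_hX₁ : X₁.card = 1),
      |locAct (cubeIn cube X ∘ γ) (actIn blk Δ ℱ adj χ p ek B Φ c Ys V cube Λ X t γ) H X₁| ≤
        θ ^ ((H.card : ℝ) + β' * ((X₁ \ H.image (cubeIn cube X ∘ γ)).card : ℝ)) := by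
  obtain ⟨C, hC1, hmain⟩ := ineq5144_locAct_singleton blk Δ ℱ adj χ cube hp n₀
  refine ⟨C, hC1, ?_⟩
  intro hΔ hχ c₀ hc₀ hcb ℓ₁ ℓ₂ hℓ₁ hℓ₂ hΦ μ₀ v hv hmean hvar hV KY hK K₁ hK₁0 hK₁ G hG hek hek1 θ β' hekθ hβ hreg hpre hKθ hvac Λ X t ht
    L _ _ hL γ H X₁ hX₁
  have hΦm : ∀ b ∈ B, Measurable (Φ b) := fun b hb =>
    (BIJ88GaussShellModulus309.continuous_and_zero_of_mod (hℓ₁ b hb) (hℓ₂ b hb) (hΦ b hb)).1.measurable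
  have htail : ∀ (i : I) (b : ↥B), cube (Sum.inl b) = i → ∀ a : ℝ, 0 ≤ a →
      (fieldLaw blk Δ ℱ {i}).real {ω | a ≤ |Φ b (ext blk {i} ω)|} ≤
        4 * Real.exp (μ₀ ^ 2 / (2 * v)) * Real.exp (-(1 / (8 * v) * a ^ 2)) :=
    fun i b hbi a ha => BIJ88GaussShellModulus309.tail_slotField_fieldLaw_of_mod blk Δ ℱ {i} (prec_corner_posDef blk Δ hΔ {i} {i})
      (hℓ₁ b b.2) (hℓ₂ b b.2) (hΦ b b.2) (hmean i b hbi).1 (hmean i b hbi).2 hv (hvar i b hbi).1 (hvar i b hbi).2 ha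
  exact hmain hΔ hχ hc₀ hcb hΦm hV hK hK₁0 hK₁ hG (by positivity) (by positivity) htail hek hek1 hekθ hβ hreg hpre hKθ hvac Λ X ht hL
    γ H X₁ hX₁

/-! ## §5 One constant for all data and all `e_k`: the closed form with the quantifiers in the usable order -/

/-- **(5.14.4) ON THE ONE-CUBE POLYMERS — ONE ALL-ORDERS CONSTANT FOR ALL DATA AND ALL `e_k`**: the constant `Ĉ = Ĉ(χ, p, n₀) ≥ 1` is chosen
FIRST (`BIJ88GaussIntegration309Product.exists_const_all_orders`); then for EVERY model datum (sites and cubes, `Δ ≻ 0` of any coupling, source,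
slots, slot fields, thresholds, terms, cube map) and EVERY charge `e_k` in the regime relative to that `Ĉ`, the one-cube bound of
`ineq5144_locAct_singleton_of_const` holds — the quantifier order under which the `e_k`-smallness conditions are met by taking `e_k` small at the
other constants fixed (the per-datum form `ineq5144_locAct_singleton` has `e_k` bound before `Ĉ`). [cite: BalabanImbrieJaffe1988, (5.14.4) p.309] -/
theorem ineq5144_locAct_singleton_uniform [Fintype ι] [Fintype υ] (hp : 1 / 2 < p) (n₀ : ℕ) :
    ∃ C : ℝ, 1 ≤ C ∧ ∀ (blk' : α → I) (Δ' : Matrix α α ℝ) (ℱ' : α → ℝ) (adj' : I → I → Prop) [DecidableRel adj']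
      {B' : Finset ι} {Φ' : ι → (α → ℝ) → ℝ} {c' : ι → ℝ} {Ys' : Finset υ} {V' : υ → (α → ℝ) → ℝ} (cube' : ↥B' ⊕ ↥Ys' → I)
      (_hΔ : Δ'.PosDef) (_hχ : ∀ x, 0 ≤ χ.χ₁ x) {c₀ : ℝ} (_hc₀ : 0 < c₀) (_hcb : ∀ b ∈ B', c₀ ≤ c' b)
      (_hΦm : ∀ b ∈ B', Measurable (Φ' b)) (_hV : ∀ Y ∈ Ys', Measurable (V' Y)) {KY : υ → ℝ} (_hK : ∀ Y ∈ Ys', ∀ φ, |V' Y φ| ≤ KY Y)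
      {K₁ : ℝ} (_hK₁0 : 0 ≤ K₁) (_hK₁ : ∀ Y ∈ Ys', KY Y ≤ K₁) {G : ℕ} (_hG : ∀ i, (univ.filter fun τ : ↥B' ⊕ ↥Ys' => cube' τ = i).card ≤ G)
      {A κ : ℝ} (_hA : 0 ≤ A) (_hκ : 0 ≤ κ)
      (_htail : ∀ (i : I) (b : ↥B'), cube' (Sum.inl b) = i → ∀ a : ℝ, 0 ≤ a →
        (fieldLaw blk' Δ' ℱ' {i}).real {ω | a ≤ |Φ' b (ext blk' {i} ω)|} ≤ A * Real.exp (-(κ * a ^ 2)))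
      {e : ℝ} (_he : 0 < e) (_he1 : e ≤ Real.exp (-1)) {θ β' : ℝ} (_heθ : e ≤ θ)
      (_hreg : (n₀ : ℝ) + 1 ≤ κ * (81 / 100) * c₀ ^ 2 * Real.log e⁻¹ ^ (2 * p - 1))
      (_hpre : C ^ n₀ * A * Real.exp (G * K₁) * e ≤ 1) (_hKθ : ∀ Y ∈ Ys', KY Y * Real.exp (G * K₁) ≤ θ)
      (_hvac : Real.exp (G * K₁) * G * A * e + (Real.exp (G * K₁) - 1) ≤ θ ^ β')
      (Λ X : Finset I) {t : ℝ} (_ht : t ∈ Set.Ioc (0 : ℝ) 1) {L : Type} [Fintype L] [DecidableEq L] (_hL : Fintype.card L ≤ n₀)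
      (γ : L → ↥(slotB B' Ys' cube' X) ⊕ ↥(slotY B' Ys' cube' X)) (H : Finset L) (X₁ : Finset I) (_hX₁ : X₁.card = 1),
      |locAct (cubeIn cube' X ∘ γ) (actIn blk' Δ' ℱ' adj' χ p e B' Φ' c' Ys' V' cube' Λ X t γ) H X₁| ≤
        θ ^ ((H.card : ℝ) + β' * ((X₁ \ H.image (cubeIn cube' X ∘ γ)).card : ℝ)) := by
  obtain ⟨C, hC1, hC⟩ := exists_const_all_orders χ p n₀
  refine ⟨C, hC1, ?_⟩
  intro blk' Δ' ℱ' adj' _ B' Φ' c' Ys' V' cube' hΔ hχ c₀ hc₀ hcb hΦm hV KY hK K₁ hK₁0 hK₁ G hG A κ hA hκ htail e he he1 θ β' heθ hreg hpre hKθ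
    hvac Λ X t ht L _ _ hL γ H X₁ hX₁
  exact ineq5144_locAct_singleton_of_const blk' Δ' ℱ' adj' χ cube' hp hC1 hC hΔ hχ hc₀ hcb hΦm hV hK hK₁0 hK₁ hG hA hκ htail he he1 heθ
    hreg hpre hKθ hvac Λ X ht hL γ H X₁ hX₁

/-! ## §6 The located leaf of a region reduces to its multi-cube part -/

/-- **THE LOCATED LEAF (5.14.4) OF A REGION'S DATA IS EQUIVALENT TO ITS MULTI-CUBE PART `|X_β| ≥ 2`** (in the one-cube regime of
`ineq5144_locAct_singleton_of_const`): r16's typed leaf `BIJ88Sect5StatementsPart2.Ineq5144` in the located reading for the data of the region `X` at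
`(Λ, t, γ)` — the hypothesis `h5144` of the C2.Eq5.14.5 head `BIJ88Eq5145CornerW6Loc.eq5145_zG_mod_W6v_of_ineq5144_loc`, one region and time at a
time — holds iff it holds on the polymers with at least two cubes: the empty polymer has activity `0` (p25's `g1_empty`), the one-cube polymers
are §3.  What remains of (5.14.4) is exactly the inductive cluster-expansion decay in `|X_β|` (p. 309: *"The proof of this estimate is similar to
the one for g₂"*, §5.13). [cite: BalabanImbrieJaffe1988, (5.14.4) p.309] -/
theorem ineq5144_locAct_iff_two_le [Fintype ι] [Fintype υ] (hp : 1 / 2 < p) {n₀ : ℕ} {C : ℝ} (hC1 : 1 ≤ C)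
    (hC : ∀ i, i ≤ n₀ → ∀ (A : ℝ) ⦃q e t : ℝ⦄, q ≠ 0 → 0 < e → 0 < t → t * e ≤ Real.exp (-1) →
      |iteratedDeriv i (fun s => cutoff χ (q * pLog p (s * e)) A) t| ≤ C * t ^ (-(i : ℤ)))
    (hΔ : Δ.PosDef) (hχ : ∀ x, 0 ≤ χ.χ₁ x) {c₀ : ℝ} (hc₀ : 0 < c₀) (hcb : ∀ b ∈ B, c₀ ≤ c b)
    (hΦm : ∀ b ∈ B, Measurable (Φ b)) (hV : ∀ Y ∈ Ys, Measurable (V Y)) {KY : υ → ℝ} (hK : ∀ Y ∈ Ys, ∀ φ, |V Y φ| ≤ KY Y)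
    {K₁ : ℝ} (hK₁0 : 0 ≤ K₁) (hK₁ : ∀ Y ∈ Ys, KY Y ≤ K₁) {G : ℕ} (hG : ∀ i, (univ.filter fun τ : ↥B ⊕ ↥Ys => cube τ = i).card ≤ G)
    {A κ : ℝ} (hA : 0 ≤ A) (hκ : 0 ≤ κ)
    (htail : ∀ (i : I) (b : ↥B), cube (Sum.inl b) = i → ∀ a : ℝ, 0 ≤ a →
      (fieldLaw blk Δ ℱ {i}).real {ω | a ≤ |Φ b (ext blk {i} ω)|} ≤ A * Real.exp (-(κ * a ^ 2)))
    (hek : 0 < ek) (hek1 : ek ≤ Real.exp (-1)) {θ β' : ℝ} (hekθ : ek ≤ θ)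
    (hreg : (n₀ : ℝ) + 1 ≤ κ * (81 / 100) * c₀ ^ 2 * Real.log ek⁻¹ ^ (2 * p - 1))
    (hpre : C ^ n₀ * A * Real.exp (G * K₁) * ek ≤ 1) (hKθ : ∀ Y ∈ Ys, KY Y * Real.exp (G * K₁) ≤ θ)
    (hvac : Real.exp (G * K₁) * G * A * ek + (Real.exp (G * K₁) - 1) ≤ θ ^ β')
    (Λ X : Finset I) {t : ℝ} (ht : t ∈ Set.Ioc (0 : ℝ) 1) {L : Type} [Fintype L] [DecidableEq L] (hL : Fintype.card L ≤ n₀)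
    (γ : L → ↥(slotB B Ys cube X) ⊕ ↥(slotY B Ys cube X)) :
    Ineq5144 (cubeSys I) (Finset L) (locAct (cubeIn cube X ∘ γ) (actIn blk Δ ℱ adj χ p ek B Φ c Ys V cube Λ X t γ))
        Finset.card (fun H (X'' : Finset I) => (X'' \ H.image (cubeIn cube X ∘ γ)).card) θ β' ↔
      ∀ (H : Finset L) (X'' : Finset I), 2 ≤ X''.card →
        |locAct (cubeIn cube X ∘ γ) (actIn blk Δ ℱ adj χ p ek B Φ c Ys V cube Λ X t γ) H X''| ≤
          θ ^ ((H.card : ℝ) + β' * ((X'' \ H.image (cubeIn cube X ∘ γ)).card : ℝ)) := by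
  refine ⟨fun h H X'' _ => h H X'', fun h H X'' => ?_⟩
  change Finset I at X''
  show |locAct (cubeIn cube X ∘ γ) (actIn blk Δ ℱ adj χ p ek B Φ c Ys V cube Λ X t γ) H X''| ≤
    θ ^ ((H.card : ℝ) + β' * ((X'' \ H.image (cubeIn cube X ∘ γ)).card : ℝ))
  have hθ0 : 0 < θ := hek.trans_le hekθ
  rcases Nat.lt_or_ge X''.card 2 with hlt | hge
  · rcases Nat.lt_or_ge X''.card 1 with h0 | h1
    · -- the empty polymer: activity `0`
      have hX : X'' = ∅ := card_eq_zero.1 (by omega)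
      subst hX
      have h0' : actIn blk Δ ℱ adj χ p ek B Φ c Ys V cube Λ X t γ H ∅ = 0 := by
        simp [actIn, prime, g3, g1_empty]
      rw [BIJ88Ineq5144Located.locAct_eq_zero_of_eq_zero h0', abs_zero]
      exact Real.rpow_nonneg hθ0.le _
    · -- a one-cube polymer: §3
      exact ineq5144_locAct_singleton_of_const blk Δ ℱ adj χ cube hp hC1 hC hΔ hχ hc₀ hcb hΦm hV hK hK₁0 hK₁ hG hA hκ htail hek hek1 hekθ
        hreg hpre hKθ hvac Λ X ht hL γ H X'' (by omega)
  · exact h H X'' hge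

end Model

end Literature.MathematicalPhysics.QuantumFieldTheory.BalabanImbrieJaffe1984to88.BIJ88Ineq5144OneCube

end
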